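import Summits.Ventures.YMGap.Thresholds.StrongCouplingTiltedMoments
import Literature.MathematicalPhysics.QuantumFieldTheory.StrongCouplingActivities
import Summits.Ventures.YMGap.Thresholds.StrongCouplingWalkResampling
import HarnessLib

/-!
# The covering-number bound: an observable with the ONE-LINK RESAMPLING PROPERTY on a finite link set `Λ` is within `O(β^m)` of its constant
# uniformly over ALL DLR states, `m` = the plaquette-covering number of `Λ` (row type C-PERIMETER-G, the abstract engine)

Cell `pub-ymgap`, seat ds-1 (gen 16). HONEST FRAMING: exact LATTICE statement for the Wilson action on `ℤ^d` with an ARBITRARY compact metrisable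
gauge group `G`, continuous `ρ` (`|Re tr ρ| ≤ M`), every `d`, both signs of `β`, uniform over all DLR states `ν ∈ 𝒢(β)`. The engine behind the
universal strong-coupling perimeter law for rectangular Wilson loops (`StrongCouplingPerimeterLawAllGroups`, …`Corners`, …`Thin`) stated once for
an ABSTRACT observable `F`: a continuous `Λ`-cylinder such that, for every link `e ∈ Λ`, `∫ F·Ψ d(dg_∞) = c·∫ Ψ d(dg_∞)` for every continuous `Ψ`
not seeing `e` (the «one-link resampling property» — for a function of a loop matrix traversing `e` once this is Haar invariance). If every
family of fewer than `m` plaquettes touching `Λ` leaves a link of `Λ` uncovered, then `|∫ F dν − c| ≤ (C + |c|)(|β|B)^m e^{2|β|B}/m!` for EVERY `β`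
and EVERY DLR state. An UPPER bound on the deviation from the constant; nothing about weak coupling, the continuum, or the Clay problem.
Intended re-use: other loop shapes (closed lattice walks, Polyakov-type contours) only need their resampling lemma. Kernel theorems only,
0 definitions, 0 compute.

* `integral_mul_prod_pi_glueWith_of_resample`, ★ `integral_sub_mul_pow_eq_zero_of_resample` (vanishing mixed kernel moments),
  ★★ `abs_integral_sub_le_of_resample_of_cover` (the bound under a covering hypothesis), ★★ `abs_integral_sub_le_of_resample` (`4m < #Λ + 4`),
  ★ `exists_forall_abs_integral_sub_le_pow_of_resample` (`∃ K ∀ β ∀ ν: ≤ K|β|^m`). Rectangles qualify by `integral_comp_rectangle_mul_eq`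
  (`StrongCouplingLoopResampling`), closed lattice walks by `integral_comp_walkHolonomy_mul_eq` (`StrongCouplingWalkResampling`); this file
  imports neither (only the tilted-moment estimates of `StrongCouplingTiltedMoments`), so that both specialisations build independently.

* Section `Walks` (the first instance, appended): for EVERY closed walk `w` of `ℤ^d` running along each of its `ℓ` links exactly once and every
  continuous test function `χ`, `isCylinder_wilsonLoopObs`, ★★★ `abs_integral_wilsonLoopObs_sub_haar_le` (`4m < ℓ + 4`:
  `|∫ χ(hol_w) dν − ∫ χ dHaar| ≤ (C + |c|)(|β|B)^m e^{2|β|B}/m!`), ★★★ `abs_integral_wilsonLoopObs_sub_haar_le_geom` (THE PERIMETER LAW for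
  self-avoiding lattice loops: `≤ (C + |c|) θ(β)^{⌈ℓ/4⌉}`, `θ(β) = e·b|β|·e^{2b|β|}`, `b = 4(N+M)(d+1)d²`, uniformly in the loop; an UPPER bound,
  meaningful once `θ(β) < 1`, NOT an area law, NOT a lower bound), ★★ `exists_forall_abs_integral_wilsonLoopObs_sub_haar_le_pow`
  (`∃ K ∀ β ∀ ν: ≤ K|β|^m`); the resampling input is `StrongCouplingWalkResampling.integral_comp_walkHolonomy_mul_eq`.

References (mechanism): K. Wilson, PRD 10 (1974) 2445; K. Osterwalder, E. Seiler, Ann. Phys. 110 (1978) 440, §3; E. Seiler, LNP 159 (1982), Ch. 2. -/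

noncomputable section

open MeasureTheory ProbabilityTheory Set Filter Topology Finset
open scoped NNReal Nat
open Literature.Probability.LatticeModels (glueWith glueWith_apply_mem glueWith_apply_not_mem IsGibbsMeasure IsSpecification)
open Literature.MathematicalPhysics.QuantumLattice (LGConfig ZdEdge ZdPlaquette ymGibbsMeasures ymSpecification plaquetteObs
  plaquetteEdges plaquettesTouching wilsonBoundaryAction IsCylinder continuous_plaquetteObs isCylinder_plaquetteObs
  continuous_wilsonBoundaryAction integrable_of_bound continuous_integral_ymSpecification abs_integral_ymSpecification_le)
open Literature.MathematicalPhysics.QuantumFieldTheory hiding ZdEdge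

namespace Summit.Ventures.YMGap.ZeroCouplingSlope

/-! ## The covering-number bound for an observable with the one-link resampling property -/

section Abstract

variable {d N : ℕ} {G : Type*} [Group G] [TopologicalSpace G] [IsTopologicalGroup G] [CompactSpace G]
  [MeasurableSpace G] [BorelSpace G] [SecondCountableTopology G] (ρ : G →* Matrix (Fin N) (Fin N) ℂ)
  {Λ : Finset (ZdEdge d)} {F : LGConfig d G → ℝ} {c : ℝ}

/-- The un-tilted kernel measure of the finite edge set `Λ` with boundary condition `η`: product Haar measure on `G^Λ`
glued with `η` off `Λ` (local notation `π⟦Λ, η⟧`, as in `StrongCouplingLoopResampling`). -/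
local notation3 (prettyPrint := false) "π⟦" Λ ", " η "⟧" =>
  ((Measure.pi fun _ : ↥(Λ : Finset (ZdEdge d)) => haarProbability G).map (glueWith Λ · (η : LGConfig d G)))

/-- ★ **Under the `β = 0` kernel of `Λ`, a product of plaquette energies missing a link `e ∈ Λ` does not see an observable with the one-link
resampling property at `e`**: `∫ F · ∏_l (N − Re tr ρ(U_{f l})) dπ⟦Λ, η⟧ = c · ∫ ∏_l (N − Re tr ρ(U_{f l})) dπ⟦Λ, η⟧` for EVERY boundary condition
`η` (transfer to `dg_∞`; the product read through the gluing ignores `U_e`). [folklore] -/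
theorem integral_mul_prod_pi_glueWith_of_resample (hρ : Continuous ρ) (hFc : Continuous F) (hFΛ : IsCylinder F Λ) {e : ZdEdge d}
    (he : e ∈ Λ) (hres : ∀ Ψ : LGConfig d G → ℝ, Continuous Ψ → (∀ (U : LGConfig d G) (g : G), Ψ (Function.update U e g) = Ψ U) →
      ∫ U, F U * Ψ U ∂zdHaar d G = c * ∫ U, Ψ U ∂zdHaar d G)
    {k : ℕ} (f : Fin k → ZdPlaquette d) (hef : ∀ l, e ∉ plaquetteEdges (f l)) (η : LGConfig d G) :
    ∫ U, F U *
        ∏ l, ((N : ℝ) - plaquetteObs ρ (f l).1 (f l).2.1.1 (f l).2.1.2 U) ∂π⟦Λ, η⟧ =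
      (c) *
        ∫ U, ∏ l, ((N : ℝ) - plaquetteObs ρ (f l).1 (f l).2.1.1 (f l).2.1.2 U) ∂π⟦Λ, η⟧ := by
  classical
  have hW : Continuous fun U : LGConfig d G => F U :=
    hFc
  have hP : Continuous fun U : LGConfig d G => ∏ l, ((N : ℝ) - plaquetteObs ρ (f l).1 (f l).2.1.1 (f l).2.1.2 U) :=
    continuous_finsetProd _ fun l _ => continuous_const.sub (continuous_plaquetteObs ρ hρ _ _ _)
  have hm1 : Measurable fun U : LGConfig d G => F U *
      ∏ l, ((N : ℝ) - plaquetteObs ρ (f l).1 (f l).2.1.1 (f l).2.1.2 U) := (hW.mul hP).measurable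
  have hm2 : Measurable fun U : LGConfig d G => ∏ l, ((N : ℝ) - plaquetteObs ρ (f l).1 (f l).2.1.1 (f l).2.1.2 U) :=
    hP.measurable
  rw [integral_pi_glueWith_eq_integral_zdHaar (Λ) η hm1,
    integral_pi_glueWith_eq_integral_zdHaar (Λ) η hm2]
  have hcyl : ∀ U : LGConfig d G, F (glueWith Λ (Λ.restrict U) η) =
      F U := fun U =>
    apply_glueWith_restrict_of_isCylinder hFΛ U η
  simp only [hcyl]
  have hΨc : Continuous fun U : LGConfig d G => ∏ l, ((N : ℝ) - plaquetteObs ρ (f l).1 (f l).2.1.1 (f l).2.1.2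
      (glueWith (Λ) ((Λ).restrict U) η)) :=
    hP.comp (continuous_glueWith_restrict (Λ) η)
  have hΨe : ∀ (U : LGConfig d G) (g : G),
      (∏ l, ((N : ℝ) - plaquetteObs ρ (f l).1 (f l).2.1.1 (f l).2.1.2
        (glueWith (Λ) ((Λ).restrict (Function.update U e g)) η))) =
      ∏ l, ((N : ℝ) - plaquetteObs ρ (f l).1 (f l).2.1.1 (f l).2.1.2
        (glueWith (Λ) ((Λ).restrict U) η)) := by
    intro U g
    refine Finset.prod_congr rfl fun l _ => ?_
    congr 1
    refine isCylinder_plaquetteObs ρ (f l) fun e' he' => ?_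
    have hne : e' ≠ e := by rintro rfl; exact hef l (Finset.mem_coe.1 he')
    by_cases he'Λ : e' ∈ Λ
    · rw [glueWith_apply_mem _ _ _ he'Λ, glueWith_apply_mem _ _ _ he'Λ]
      show Function.update U e g e' = U e'
      rw [Function.update_of_ne hne]
    · rw [glueWith_apply_not_mem _ _ _ he'Λ, glueWith_apply_not_mem _ _ _ he'Λ]
  exact hres _ hΨc hΨe

/-- ★ **Vanishing of the first mixed kernel moments.** If `F` has the one-link resampling property (constant `c`) at every link of `Λ` and every
family of `k` plaquettes touching `Λ` leaves a link of `Λ` uncovered, then `∫ (F − c) · S_Λ^k dπ⟦Λ, η⟧ = 0` for EVERY boundary condition `η`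
(`S_Λ` the boundary Wilson action of `Λ`; multinomial expansion). [folklore] -/
theorem integral_sub_mul_pow_eq_zero_of_resample (hρ : Continuous ρ) (hFc : Continuous F) (hFΛ : IsCylinder F Λ)
    (hres : ∀ e ∈ Λ, ∀ Ψ : LGConfig d G → ℝ, Continuous Ψ → (∀ (U : LGConfig d G) (g : G), Ψ (Function.update U e g) = Ψ U) →
      ∫ U, F U * Ψ U ∂zdHaar d G = c * ∫ U, Ψ U ∂zdHaar d G) {k : ℕ}
    (hcov : ∀ f : Fin k → ZdPlaquette d, (∀ l, f l ∈ plaquettesTouching Λ) → ∃ e ∈ Λ, ∀ l, e ∉ plaquetteEdges (f l))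
    (η : LGConfig d G) :
    ∫ U, (F U - c) *
        wilsonBoundaryAction ρ (Λ) U ^ k ∂π⟦Λ, η⟧ = 0 := by
  classical
  have hSc : ∀ q : ZdPlaquette d, Continuous fun U : LGConfig d G => (N : ℝ) - plaquetteObs ρ q.1 q.2.1.1 q.2.1.2 U :=
    fun q => continuous_const.sub (continuous_plaquetteObs ρ hρ _ _ _)
  have hW : Continuous fun U : LGConfig d G => F U :=
    hFc
  have hPc : ∀ f : Fin k → ZdPlaquette d,
      Continuous fun U : LGConfig d G => ∏ l, ((N : ℝ) - plaquetteObs ρ (f l).1 (f l).2.1.1 (f l).2.1.2 U) := fun f =>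
    continuous_finsetProd _ fun l _ => hSc (f l)
  have hexp : ∀ U : LGConfig d G, wilsonBoundaryAction ρ (Λ) U ^ k =
      ∑ f ∈ Fintype.piFinset (fun _ : Fin k => plaquettesTouching (Λ)),
        ∏ l, ((N : ℝ) - plaquetteObs ρ (f l).1 (f l).2.1.1 (f l).2.1.2 U) := fun U => by
    rw [wilsonBoundaryAction, ← Fin.prod_const k]
    exact Finset.prod_univ_sum (fun _ : Fin k => plaquettesTouching (Λ))
      (fun (_ : Fin k) (q : ZdPlaquette d) => (N : ℝ) - plaquetteObs ρ q.1 q.2.1.1 q.2.1.2 U)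
  have hI1 : ∀ f : Fin k → ZdPlaquette d, Integrable (fun U : LGConfig d G => F U *
      ∏ l, ((N : ℝ) - plaquetteObs ρ (f l).1 (f l).2.1.1 (f l).2.1.2 U)) π⟦Λ, η⟧ := fun f =>
    integrable_pi_glueWith_of_continuous _ η (hW.mul (hPc f))
  have hI2 : ∀ f : Fin k → ZdPlaquette d, Integrable (fun U : LGConfig d G =>
      ∏ l, ((N : ℝ) - plaquetteObs ρ (f l).1 (f l).2.1.1 (f l).2.1.2 U)) π⟦Λ, η⟧ := fun f =>
    integrable_pi_glueWith_of_continuous _ η (hPc f)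
  have hre : ∀ U : LGConfig d G,
      (F U - c) *
          wilsonBoundaryAction ρ (Λ) U ^ k =
        ∑ f ∈ Fintype.piFinset (fun _ : Fin k => plaquettesTouching (Λ)),
          (F U * ∏ l, ((N : ℝ) - plaquetteObs ρ (f l).1 (f l).2.1.1 (f l).2.1.2 U) -
            (c) * ∏ l, ((N : ℝ) - plaquetteObs ρ (f l).1 (f l).2.1.1 (f l).2.1.2 U)) :=
    fun U => by
    rw [hexp U, Finset.mul_sum]
    exact Finset.sum_congr rfl fun f _ => by ring
  simp_rw [hre]
  have hI3 : ∀ f : Fin k → ZdPlaquette d, Integrable (fun U : LGConfig d G =>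
      F U * ∏ l, ((N : ℝ) - plaquetteObs ρ (f l).1 (f l).2.1.1 (f l).2.1.2 U) -
        (c) * ∏ l, ((N : ℝ) - plaquetteObs ρ (f l).1 (f l).2.1.1 (f l).2.1.2 U))
      π⟦Λ, η⟧ := fun f => (hI1 f).sub' ((hI2 f).const_mul _)
  rw [integral_finsetSum _ fun f _ => hI3 f]
  refine Finset.sum_eq_zero fun f hf => ?_
  have hfT : ∀ l, f l ∈ plaquettesTouching (Λ) := fun l => Fintype.mem_piFinset.1 hf l
  obtain ⟨e, he, hef⟩ := hcov f hfT
  rw [integral_sub (hI1 f) ((hI2 f).const_mul _), integral_const_mul,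
    integral_mul_prod_pi_glueWith_of_resample ρ hρ hFc hFΛ he (hres e he) f hef η, sub_self]

/-! ### The bound -/

variable [T2Space G]

/-- ★★ **THE COVERING-NUMBER BOUND.** Let `ρ` be continuous with `|Re tr ρ| ≤ M`, `F` a continuous `Λ`-cylinder with `|F| ≤ C` having the
one-link resampling property with constant `c` at every link of `Λ` (under `dg_∞`, `F` integrates to `c` against every continuous function
not seeing that link), and suppose every family of fewer than `m` plaquettes touching `Λ` leaves a link of `Λ` uncovered. Then for EVERY real `β`
and EVERY `ν ∈ 𝒢(β)`: `|∫ F dν − c| ≤ (C + |c|) (|β| B)^m e^{2|β|B} / m!`, `B = (N + M) #plaquettesTouching Λ` — every compact gauge group, no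
cluster expansion, no uniqueness (DLR at `Λ` + vanishing mixed kernel moments + the reweighting lemma of `StrongCouplingTiltedMoments`). The
rectangular Wilson loops of `StrongCouplingPerimeterLawAllGroups` are the case `Λ` = loop links, `F = ψ(U_{R×T})`. [folklore] -/
theorem abs_integral_sub_le_of_resample_of_cover (hρ : Continuous ρ) {M : ℝ} (hM : ∀ g : G, |(ρ g).trace.re| ≤ M)
    (hFc : Continuous F) (hFΛ : IsCylinder F Λ) {C : ℝ} (hFC : ∀ U, |F U| ≤ C)
    (hres : ∀ e ∈ Λ, ∀ Ψ : LGConfig d G → ℝ, Continuous Ψ → (∀ (U : LGConfig d G) (g : G), Ψ (Function.update U e g) = Ψ U) →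
      ∫ U, F U * Ψ U ∂zdHaar d G = c * ∫ U, Ψ U ∂zdHaar d G) {m : ℕ}
    (hcov : ∀ (k : ℕ) (f : Fin k → ZdPlaquette d), k < m → (∀ l, f l ∈ plaquettesTouching Λ) → ∃ e ∈ Λ, ∀ l, e ∉ plaquetteEdges (f l))
    (β : ℝ) {ν : Measure (LGConfig d G)} (hν : ν ∈ ymGibbsMeasures (d := d) ρ β) :
    |(∫ U, F U ∂ν) - c| ≤
      (C + |c|) *
        (|β| * (((N : ℝ) + M) * (plaquettesTouching (Λ)).card)) ^ m *
        Real.exp (2 * (|β| * (((N : ℝ) + M) * (plaquettesTouching (Λ)).card))) / m ! := by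
  classical
  set Λ := Λ with hΛ
  set c : ℝ := c with hc
  set B : ℝ := ((N : ℝ) + M) * (plaquettesTouching Λ).card with hB
  set K : ℝ := (C + |c|) * (|β| * B) ^ m * Real.exp (2 * (|β| * B)) / m ! with hK
  have hFm : Measurable F := hFc.measurable
  have hWm : Measurable (wilsonBoundaryAction (G := G) ρ Λ) := (continuous_wilsonBoundaryAction ρ hρ Λ).measurable
  have hWB : ∀ U : LGConfig d G, |wilsonBoundaryAction ρ Λ U| ≤ B := fun U => abs_wilsonBoundaryAction_le_card ρ hM Λ U
  have hker : ∀ η : LGConfig d G, |(∫ U, F U ∂(ymSpecification ρ β Λ η)) - c| ≤ K := by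
    intro η
    haveI : IsProbabilityMeasure π⟦Λ, η⟧ := isProbabilityMeasure_pi_glueWith Λ η
    have hmom : ∀ k < m, ∫ U, (F U - c) * wilsonBoundaryAction ρ Λ U ^ k ∂π⟦Λ, η⟧ = 0 := fun k hk =>
      integral_sub_mul_pow_eq_zero_of_resample ρ hρ hFc hFΛ hres (fun f hf => hcov k f hk hf) η
    exact abs_integral_tilted_sub_const_le_pow (P := π⟦Λ, η⟧) hFm hFC hWm hWB c hmom β
  have hγ : IsSpecification (ymSpecification (d := d) ρ β) := isSpecification_ymSpecification_of_t2Space ρ hρ β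
  have hνG : IsGibbsMeasure (ymSpecification (d := d) ρ β) ν := hν
  haveI : IsProbabilityMeasure ν := hνG.isProbabilityMeasure
  have hDLR : ∫ η, (∫ U, F U ∂(ymSpecification ρ β Λ η)) ∂ν = ∫ U, F U ∂ν := by
    simpa only [Measure.restrict_univ] using hνG.setIntegral_integral_spec hγ Λ (B := Set.univ) MeasurableSet.univ hFm hFC
  have hint : Integrable (fun η => ∫ U, F U ∂(ymSpecification ρ β Λ η)) ν := integrable_of_bound
    (continuous_integral_ymSpecification ρ hρ β Λ hFc hFC).aestronglyMeasurable (abs_integral_ymSpecification_le ρ hρ β Λ hFC)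
  rw [show (∫ U, F U ∂ν) - c = ∫ η, ((∫ U, F U ∂(ymSpecification ρ β Λ η)) - c) ∂ν by
    rw [integral_sub hint (integrable_const _), integral_const, probReal_univ, one_smul, hDLR]]
  have h := norm_integral_le_of_norm_le_const (μ := ν) (C := K) (f := fun η => (∫ U, F U ∂(ymSpecification ρ β Λ η)) - c)
    (ae_of_all _ fun η => by simpa only [Real.norm_eq_abs] using hker η)
  rw [probReal_univ, mul_one] at h
  simpa only [Real.norm_eq_abs] using h

/-- Counting (a private copy of `StrongCouplingLoopResampling`'s `exists_mem_forall_not_mem_plaquetteEdges`, kept here so that this file does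
not import the rectangle geometry): `k` plaquettes cover at most `4k` links, so `4k < #Λ` leaves a link of `Λ` uncovered. [folklore] -/
private theorem exists_mem_forall_not_mem_plaquetteEdges_aux {k : ℕ} (f : Fin k → ZdPlaquette d) (h : 4 * k < Λ.card) :
    ∃ e ∈ Λ, ∀ l, e ∉ plaquetteEdges (f l) := by
  classical
  by_contra hcon
  push Not at hcon
  have hsub : Λ ⊆ Finset.univ.biUnion fun l => plaquetteEdges (f l) := fun e he => by
    obtain ⟨l, hl⟩ := hcon e he
    exact Finset.mem_biUnion.2 ⟨l, Finset.mem_univ _, hl⟩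
  have h4 : ∀ q : ZdPlaquette d, (plaquetteEdges q).card ≤ 4 := fun q => by
    unfold plaquetteEdges; exact Finset.card_le_four
  have h1 := Finset.card_le_card hsub
  have h2 : (Finset.univ.biUnion fun l => plaquetteEdges (f l)).card ≤ 4 * k :=
    calc _ ≤ ∑ l, (plaquetteEdges (f l)).card := Finset.card_biUnion_le
      _ ≤ ∑ _l : Fin k, 4 := Finset.sum_le_sum fun l _ => h4 (f l)
      _ = 4 * k := by simp [mul_comm]
  omega

/-- ★★ **The crude count**: `m − 1` plaquettes cover at most `4(m−1)` links, so for `4m < #Λ + 4` the covering hypothesis holds and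
`|∫ F dν − c| ≤ (C + |c|) (|β| B)^m e^{2|β|B} / m!` for EVERY `β` and EVERY `ν ∈ 𝒢(β)`. [folklore] -/
theorem abs_integral_sub_le_of_resample (hρ : Continuous ρ) {M : ℝ} (hM : ∀ g : G, |(ρ g).trace.re| ≤ M)
    (hFc : Continuous F) (hFΛ : IsCylinder F Λ) {C : ℝ} (hFC : ∀ U, |F U| ≤ C)
    (hres : ∀ e ∈ Λ, ∀ Ψ : LGConfig d G → ℝ, Continuous Ψ → (∀ (U : LGConfig d G) (g : G), Ψ (Function.update U e g) = Ψ U) →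
      ∫ U, F U * Ψ U ∂zdHaar d G = c * ∫ U, Ψ U ∂zdHaar d G) {m : ℕ} (hm : 4 * m < Λ.card + 4)
    (β : ℝ) {ν : Measure (LGConfig d G)} (hν : ν ∈ ymGibbsMeasures (d := d) ρ β) :
    |(∫ U, F U ∂ν) - c| ≤
      (C + |c|) * (|β| * (((N : ℝ) + M) * (plaquettesTouching Λ).card)) ^ m *
        Real.exp (2 * (|β| * (((N : ℝ) + M) * (plaquettesTouching Λ).card))) / m ! :=
  abs_integral_sub_le_of_resample_of_cover ρ hρ hM hFc hFΛ hFC hres (fun k f hk _ =>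
    exists_mem_forall_not_mem_plaquetteEdges_aux f (by omega)) β hν

/-- ★★ **Constant-free form**: under the same hypotheses (`4m < #Λ + 4`) there is `K` with `|∫ F dν − c| ≤ K |β|^m` for EVERY real `β` and
EVERY `ν ∈ 𝒢(β)`. [folklore] -/
theorem exists_forall_abs_integral_sub_le_pow_of_resample (hρ : Continuous ρ) (hFc : Continuous F) (hFΛ : IsCylinder F Λ) {C : ℝ}
    (hFC : ∀ U, |F U| ≤ C)
    (hres : ∀ e ∈ Λ, ∀ Ψ : LGConfig d G → ℝ, Continuous Ψ → (∀ (U : LGConfig d G) (g : G), Ψ (Function.update U e g) = Ψ U) →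
      ∫ U, F U * Ψ U ∂zdHaar d G = c * ∫ U, Ψ U ∂zdHaar d G) {m : ℕ} (hm : 4 * m < Λ.card + 4) :
    ∃ K : ℝ, ∀ (β : ℝ) (ν : Measure (LGConfig d G)), ν ∈ ymGibbsMeasures (d := d) ρ β → |(∫ U, F U ∂ν) - c| ≤ K * |β| ^ m := by
  classical
  obtain ⟨M, hM0, hM⟩ := exists_bound_trace_re_nonneg ρ hρ
  set B : ℝ := ((N : ℝ) + M) * (plaquettesTouching Λ).card with hB
  have hB0 : 0 ≤ B := by positivity
  obtain ⟨U₀⟩ : Nonempty (LGConfig d G) := ⟨fun _ => 1⟩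
  have hC0 : 0 ≤ C := (abs_nonneg _).trans (hFC U₀)
  refine ⟨(C + |c|) * (B ^ m * Real.exp (2 * B) + 1), fun β ν hν => ?_⟩
  have hCc : 0 ≤ C + |c| := by positivity
  rcases le_or_gt |β| 1 with hβ | hβ
  · refine (abs_integral_sub_le_of_resample ρ hρ hM hFc hFΛ hFC hres hm β hν).trans ?_
    rw [mul_pow, hB.symm] at *
    have hfac : (1 : ℝ) ≤ m ! := by exact_mod_cast Nat.one_le_iff_ne_zero.2 (Nat.factorial_ne_zero m)
    have hexp : Real.exp (2 * (|β| * B)) ≤ Real.exp (2 * B) := Real.exp_le_exp.2 (by nlinarith)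
    calc (C + |c|) * (|β| ^ m * B ^ m) * Real.exp (2 * (|β| * B)) / m !
        ≤ (C + |c|) * (|β| ^ m * B ^ m) * Real.exp (2 * B) / 1 := by
          gcongr
      _ = (C + |c|) * (B ^ m * Real.exp (2 * B)) * |β| ^ m := by ring
      _ ≤ (C + |c|) * (B ^ m * Real.exp (2 * B) + 1) * |β| ^ m := by gcongr; linarith
  · have hνG : IsGibbsMeasure (ymSpecification (d := d) ρ β) ν := hν
    haveI : IsProbabilityMeasure ν := hνG.isProbabilityMeasure
    have h1 : |∫ U, F U ∂ν| ≤ C := by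
      have h := norm_integral_le_of_norm_le_const (μ := ν) (C := C) (f := F)
        (ae_of_all _ fun U => by simpa only [Real.norm_eq_abs] using hFC U)
      rw [probReal_univ, mul_one] at h
      simpa only [Real.norm_eq_abs] using h
    have h2 : |(∫ U, F U ∂ν) - c| ≤ C + |c| := (abs_sub _ _).trans (by linarith)
    refine h2.trans ?_
    have h3 : (1 : ℝ) ≤ |β| ^ m := one_le_pow₀ hβ.le
    have h4 : (1 : ℝ) ≤ B ^ m * Real.exp (2 * B) + 1 := by
      have : 0 ≤ B ^ m * Real.exp (2 * B) := by positivity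
      linarith
    calc C + |c| = (C + |c|) * 1 * 1 := by ring
      _ ≤ (C + |c|) * (B ^ m * Real.exp (2 * B) + 1) * |β| ^ m := by gcongr

end Abstract

/-! ## First instance: the Wilson loop observable of an arbitrary closed lattice walk without repeated links
(`|∫ χ(hol_w) dν − ∫ χ dHaar| = O(β^{⌈ℓ/4⌉})`, `ℓ` = number of links, uniformly over ALL DLR states, every compact gauge group)

HONEST FRAMING: for EVERY continuous test function `χ` (`|χ| ≤ C`) and EVERY closed walk `w` of `ℤ^d` running along each link at most once
(non-planar, knotted, any shape) an UPPER bound of perimeter ORDER `⌈ℓ/4⌉` on the deviation of `∫ χ(hol_w) dν` from the Haar mean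
(`wilsonLoopObs χ w` of `WilsonLoops.lean`); no lower bound, no area law, nothing about weak coupling or the continuum. Mechanism: the walk
holonomy has the one-link resampling property at every link it runs along exactly once (`StrongCouplingWalkResampling`), so the engine above
applies with `Λ` = the walk's links. -/

open Literature.Probability.LatticeModels (zdGraph)
open Literature.MathematicalPhysics.QuantumLattice (dartStep walkHolonomy wilsonLoopObs)

section Walks

variable {d N : ℕ} {G : Type*} [Group G] [TopologicalSpace G] [IsTopologicalGroup G] [CompactSpace G]
  [MeasurableSpace G] [BorelSpace G] [SecondCountableTopology G] [T2Space G] (ρ : G →* Matrix (Fin N) (Fin N) ℂ)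

omit [TopologicalSpace G] [IsTopologicalGroup G] [CompactSpace G] [MeasurableSpace G] [BorelSpace G] [SecondCountableTopology G] [T2Space G] in
/-- The Wilson loop observable of a walk is a cylinder observable supported on the links along which the walk runs. [folklore] -/
theorem isCylinder_wilsonLoopObs (χ : G → ℝ) {x : Literature.Probability.LatticeModels.Site d} (w : (zdGraph d).Walk x x) :
    IsCylinder (wilsonLoopObs χ w : LGConfig d G → ℝ) (w.darts.map fun δ => (dartStep δ).1).toFinset := by
  intro U V h
  simp only [wilsonLoopObs]
  have hUV : walkHolonomy U w = walkHolonomy V w := dependsOn_walkHolonomy w (fun e he => h e (by simpa using he))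
  rw [hUV]

/-- ★★★ **UNIVERSAL STRONG-COUPLING BOUND FOR THE WILSON LOOP OF EVERY CLOSED LATTICE WALK WITHOUT REPEATED LINKS — every compact gauge group,
every DLR state.** For continuous `ρ` with `|Re tr ρ| ≤ M`, a continuous test function `χ` with `|χ| ≤ C`, a closed walk `w` whose links are pairwise
distinct (`ℓ` of them) and every `m` with `4m < ℓ + 4`, for EVERY real `β` and EVERY `ν ∈ 𝒢(β)`:
`|∫ χ(hol_w) dν − ∫ χ dHaar| ≤ (C + |∫ χ dHaar|)(|β|B)^m e^{2|β|B}/m!`, `B = (N + M) #plaquettesTouching(links of w)`. [folklore] -/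
theorem abs_integral_wilsonLoopObs_sub_haar_le (hρ : Continuous ρ) {M : ℝ} (hM : ∀ g : G, |(ρ g).trace.re| ≤ M)
    {χ : G → ℝ} (hχ : Continuous χ) {C : ℝ} (hχC : ∀ g, |χ g| ≤ C) {x : Literature.Probability.LatticeModels.Site d}
    (w : (zdGraph d).Walk x x) (hnd : (w.darts.map fun δ => (dartStep δ).1).Nodup) {m : ℕ}
    (hm : 4 * m < (w.darts.map fun δ => (dartStep δ).1).toFinset.card + 4) (β : ℝ) {ν : Measure (LGConfig d G)}
    (hν : ν ∈ ymGibbsMeasures (d := d) ρ β) :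
    |(∫ U, wilsonLoopObs χ w U ∂ν) - ∫ g, χ g ∂haarProbability G| ≤
      (C + |∫ g, χ g ∂haarProbability G|) *
        (|β| * (((N : ℝ) + M) * (plaquettesTouching (w.darts.map fun δ => (dartStep δ).1).toFinset).card)) ^ m *
        Real.exp (2 * (|β| * (((N : ℝ) + M) * (plaquettesTouching (w.darts.map fun δ => (dartStep δ).1).toFinset).card))) / m ! :=
  abs_integral_sub_le_of_resample ρ hρ hM ((hχ.comp (continuous_walkHolonomy w) : Continuous fun U : LGConfig d G => χ (walkHolonomy U w)))
    (isCylinder_wilsonLoopObs χ w) (fun _ => hχC _)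
    (fun e he Ψ hΨ hΨe => integral_comp_walkHolonomy_mul_eq hχ w (by simpa using he) hnd hΨ hΨe) hm β hν

/-- ★★★ **THE UNIVERSAL PERIMETER LAW FOR SELF-AVOIDING LATTICE LOOPS.** For continuous `ρ` with `|Re tr ρ| ≤ M` (`M ≥ 0`), a continuous test
function `χ` with `|χ| ≤ C`, a closed walk `w` with pairwise distinct links (`ℓ` of them) and `m = ⌈ℓ/4⌉` (hypotheses `4m < ℓ + 4`, `ℓ ≤ 4m`), for
EVERY real `β` and EVERY `ν ∈ 𝒢(β)`: `|∫ χ(hol_w) dν − ∫ χ dHaar| ≤ (C + |∫ χ dHaar|) · θ(β)^m`, `θ(β) = e · b|β| · e^{2b|β|}`, `b = 4(N + M)(d + 1)d²` —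
exponential decay in the LENGTH of the loop, uniformly over all self-avoiding loops of every shape and all DLR states, for every compact gauge
group (an upper bound; meaningful once `θ(β) < 1`; `#plaquettesTouching ≤ ℓ(d+1)d² ≤ 4m(d+1)d²`, `m^m/m! ≤ e^m`). [folklore] -/
theorem abs_integral_wilsonLoopObs_sub_haar_le_geom (hρ : Continuous ρ) {M : ℝ} (hM0 : 0 ≤ M) (hM : ∀ g : G, |(ρ g).trace.re| ≤ M)
    {χ : G → ℝ} (hχ : Continuous χ) {C : ℝ} (hχC : ∀ g, |χ g| ≤ C) {x : Literature.Probability.LatticeModels.Site d}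
    (w : (zdGraph d).Walk x x) (hnd : (w.darts.map fun δ => (dartStep δ).1).Nodup) {m : ℕ}
    (hm : 4 * m < (w.darts.map fun δ => (dartStep δ).1).toFinset.card + 4) (hm' : (w.darts.map fun δ => (dartStep δ).1).toFinset.card ≤ 4 * m)
    (β : ℝ) {ν : Measure (LGConfig d G)} (hν : ν ∈ ymGibbsMeasures (d := d) ρ β) :
    |(∫ U, wilsonLoopObs χ w U ∂ν) - ∫ g, χ g ∂haarProbability G| ≤
      (C + |∫ g, χ g ∂haarProbability G|) *
        (Real.exp 1 * (4 * ((N : ℝ) + M) * ((d : ℝ) + 1) * (d : ℝ) ^ 2) * |β| *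
          Real.exp (2 * (4 * ((N : ℝ) + M) * ((d : ℝ) + 1) * (d : ℝ) ^ 2) * |β|)) ^ m := by
  refine (abs_integral_wilsonLoopObs_sub_haar_le ρ hρ hM hχ hχC w hnd hm β hν).trans ?_
  set Λ := (w.darts.map fun δ => (dartStep δ).1).toFinset with hΛ
  have hC0 : 0 ≤ C := (abs_nonneg _).trans (hχC 1)
  set c : ℝ := ∫ g, χ g ∂haarProbability G with hc
  set b : ℝ := 4 * ((N : ℝ) + M) * ((d : ℝ) + 1) * (d : ℝ) ^ 2 with hb
  set B : ℝ := ((N : ℝ) + M) * (plaquettesTouching Λ).card with hB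
  have hCc : 0 ≤ C + |c| := by positivity
  have hNM : 0 ≤ (N : ℝ) + M := by positivity
  have hcard : ((plaquettesTouching Λ).card : ℝ) ≤ Λ.card * ((d : ℝ) + 1) * (d : ℝ) ^ 2 := by
    exact_mod_cast Literature.MathematicalPhysics.QuantumFieldTheory.card_plaquettesTouching_le Λ
  have hΛm : (Λ.card : ℝ) ≤ 4 * (m : ℝ) := by exact_mod_cast hm'
  have hBle : B ≤ b * m := by
    calc B = ((N : ℝ) + M) * (plaquettesTouching Λ).card := rfl
      _ ≤ ((N : ℝ) + M) * (Λ.card * ((d : ℝ) + 1) * (d : ℝ) ^ 2) := mul_le_mul_of_nonneg_left hcard hNM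
      _ = ((N : ℝ) + M) * Λ.card * (((d : ℝ) + 1) * (d : ℝ) ^ 2) := by ring
      _ ≤ ((N : ℝ) + M) * (4 * (m : ℝ)) * (((d : ℝ) + 1) * (d : ℝ) ^ 2) := by gcongr
      _ = b * m := by rw [hb]; ring
  have hB0 : 0 ≤ B := by positivity
  have hb0 : 0 ≤ b := by positivity
  have hβB : |β| * B ≤ |β| * b * m := by rw [mul_assoc]; exact mul_le_mul_of_nonneg_left hBle (abs_nonneg β)
  have h1 : (|β| * B) ^ m ≤ (|β| * b) ^ m * (m : ℝ) ^ m := by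
    rw [← mul_pow]; exact pow_le_pow_left₀ (by positivity) hβB m
  have h2 : (m : ℝ) ^ m / m ! ≤ Real.exp m := Real.pow_div_factorial_le_exp (m : ℝ) (Nat.cast_nonneg m) m
  have h3 : Real.exp (2 * (|β| * B)) ≤ Real.exp (2 * b * |β|) ^ m := by
    rw [← Real.exp_nat_mul]; exact Real.exp_le_exp.2 (by nlinarith)
  have key : (|β| * B) ^ m / m ! * Real.exp (2 * (|β| * B)) ≤ (|β| * b) ^ m * Real.exp m * Real.exp (2 * b * |β|) ^ m := by
    refine mul_le_mul ?_ h3 (by positivity) (by positivity)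
    calc (|β| * B) ^ m / m ! ≤ (|β| * b) ^ m * (m : ℝ) ^ m / m ! := by gcongr
      _ = (|β| * b) ^ m * ((m : ℝ) ^ m / m !) := by ring
      _ ≤ (|β| * b) ^ m * Real.exp m := by gcongr
  have hem : Real.exp (m : ℝ) = Real.exp 1 ^ m := by rw [← Real.exp_nat_mul, mul_one]
  calc (C + |c|) * (|β| * B) ^ m * Real.exp (2 * (|β| * B)) / m !
      = (C + |c|) * ((|β| * B) ^ m / m ! * Real.exp (2 * (|β| * B))) := by ring
    _ ≤ (C + |c|) * ((|β| * b) ^ m * Real.exp m * Real.exp (2 * b * |β|) ^ m) := mul_le_mul_of_nonneg_left key hCc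
    _ = (C + |c|) * (Real.exp 1 * b * |β| * Real.exp (2 * b * |β|)) ^ m := by rw [hem]; ring

/-- ★★ **Constant-free form**: for a closed walk without repeated links (`ℓ` links) and `4m < ℓ + 4` there is `K` (depending on `w`, `χ`, `ρ`, `d`)
with `|∫ χ(hol_w) dν − ∫ χ dHaar| ≤ K |β|^m` for EVERY real `β` and EVERY `ν ∈ 𝒢(β)`. [folklore] -/
theorem exists_forall_abs_integral_wilsonLoopObs_sub_haar_le_pow (hρ : Continuous ρ) {χ : G → ℝ} (hχ : Continuous χ)
    {x : Literature.Probability.LatticeModels.Site d} (w : (zdGraph d).Walk x x) (hnd : (w.darts.map fun δ => (dartStep δ).1).Nodup)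
    {m : ℕ} (hm : 4 * m < (w.darts.map fun δ => (dartStep δ).1).toFinset.card + 4) :
    ∃ K : ℝ, ∀ (β : ℝ) (ν : Measure (LGConfig d G)), ν ∈ ymGibbsMeasures (d := d) ρ β →
      |(∫ U, wilsonLoopObs χ w U ∂ν) - ∫ g, χ g ∂haarProbability G| ≤ K * |β| ^ m := by
  obtain ⟨C, hC⟩ := isCompact_univ.exists_bound_of_continuousOn hχ.continuousOn
  have hχC : ∀ g, |χ g| ≤ C := fun g => (Real.norm_eq_abs _).symm.le.trans (hC g (Set.mem_univ _))
  exact exists_forall_abs_integral_sub_le_pow_of_resample ρ hρ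
    ((hχ.comp (continuous_walkHolonomy w) : Continuous fun U : LGConfig d G => χ (walkHolonomy U w)))
    (isCylinder_wilsonLoopObs χ w) (fun _ => hχC _)
    (fun e he Ψ hΨ hΨe => integral_comp_walkHolonomy_mul_eq hχ w (by simpa using he) hnd hΨ hΨe) hm

end Walks

end Summit.Ventures.YMGap.ZeroCouplingSlope
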